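import Literature.MathematicalPhysics.QuantumFieldTheory.Balaban1983to89.Node00.Record5
import Literature.MathematicalPhysics.QuantumFieldTheory.Balaban1983to89.B14NodeKnitMachine

/-!
# `Balaban1983to89.B14NodeKnitRecord5` — YM-DAG node N11 · [Balaban1988Convergent] CMP **119** (1988) 243–285, Theorem 1 p. 262
# (with the Theorem of p. 245 and the ASSUMED operation 𝐑 of p. 244): the N11 knit AT NODE 00's STAGE-5 RECORD
# `Node00.IsRecordOfRecord₅ F N D w` — pins (P1)∕(P3) REDUCED to the record's residual fields, MODULO EXACTLY TWO DISPLAYED PRINTED SLOTS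

statement-level bookkeeping over published theorems with citation tags; kernel-checked compositions of tree theorems;
nothing here is a claim about the Yang–Mills mass gap.

CITATION HEADER (lean-in-tree rule).  Source: T. Bałaban, *Convergent renormalization expansions for lattice gauge theories*,
Commun. Math. Phys. **119**, 243–285 (1988), doi:10.1007/bf01217741 [Balaban1988Convergent] (cell paper B14 = «[III]»).  Seat
`pub-ymgap-dag-n11-a` (YM-PLAN Track A, HUMAN RULING D-0062: the KNIT-BY-NAME seat of node N11; R420 ∕ R422 ∕ R424; director-ym LINE №12).
BY NAME and UNCHANGED: `…B14NodeKnitMachine` (`b14_main_of_machine_record`, `rOpLeaf_mk_iff`), `…B14NodeKnit` (`rOpLeaf_of_up_eq`),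
`…Node00.Record5` (seat pub-ymgap-node00-def: `IsRecordOfRecord₅`, `Stage5Params`, `Residual₅`, `machineOfRecord₅`, `densOfRecord₅`,
`datumOfRecord₅`, `upOfRecord₅`, `dens_machineOfRecord₅`, `sect2Form_datumOfRecord₅_iff`), `…Node00.DatumAvLayer` (`avOfRecord`,
`TrhoOfRecord`, `rhoZeroOfRecord`), `…Dag` (`B14_main` :224), `…DagBinding` (`leavesP`, `ROpLeaf`), `…B14` (`RAssumedP244`).

WHAT THE STAGE-5 RECORD PINS FOR N11 AND WHAT IT LEAVES (seat node00-def `STAGE5-SCOPING-g28.md` §4 row S_N11: «(P2) → ₆ + ₇»).  At a record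
`(D, w)` with parameters `θ`: `w.C = (machineOfRecord₅ θ).construction (avOfRecord F N)`, so the node's conclusion `densitiesDescribed` reads
`∀ k ≤ K, θ.res.S218 P k (ρ_k)` at the DETERMINED densities `ρ_k = densOfRecord₅ θ P k` (`ρ₀ = rhoZeroOfRecord …`, `ρ_{k+1} = θ.res.R P k
(TrhoOfRecord F N P.K k ρ_k)`); and `w.up P = upOfRecord₅ θ P`, so the node's 𝐑-hypothesis `rOperation` reads `ROpLeaf (θ.res.V P)` — the
RESIDUAL 𝐑-carrier, NOT YET built from `θ.res.R` and `θ.res.S218` (that is NODE 00 Stage 7, seat pub-ymgap-node00-def-R, and Stage 6's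
T-image companion of `S218`).  Hence over Stage 5 the knit keeps ONE located pin, displayed as a hypothesis on the residual fields:
(P1₅) `hV : ROpLeaf (θ.res.V P) → B14.RAssumedP244 (θ.res.R P) Scorr S P.K` — «the 𝐑-leaf of record speaks about the record's own `R`
and format spaces» (at Stage 7, with `θ.res.V P = ⟨F.P P.K, SU N, …, P.K, θ.res.R P, Scorr, S⟩`, it is `Iff.rfl`:
`B14NodeKnitMachine.rOpLeaf_mk_iff`); and (P3₅) `hS : S k ρ_k → θ.res.S218 P k ρ_k` — «the index-`k` space implies the (2.18) format» (with
`S := θ.res.S218 P` it is `id`; kept as a pin so that `S` may be the Stage-6 typed format while `S218` is still residual).  The two DISPLAYED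
PRINTED SLOTS are unchanged: (S0) the Wilson start of record lies in the index-0 space; (S1) THE THEOREM OF p. 245 along the record's tower
through NODE 00's renormalisation transform of record `TrhoOfRecord`.

WHAT THIS FILE PROVES (0 `sorry`, 0 `def`, standard axioms).
§1 `b14_main_at_stage5Params` — N11 at a run `P` of ANY world bound to the datum of record at `θ` (`w.C = (datumOfRecord₅ F N θ).C`) whose
   upstream block at `P` is the record's (`w.up P = upOfRecord₅ F N θ P`), from (P1₅), (P3₅), (S0), (S1).  `…_S218`: the same with
   `S := θ.res.S218 P` (no (P3₅)).  `rOperation_iff_rOpLeaf_res` ∕ `densitiesDescribed_iff_S218`: at such a world the node's 𝐑-hypothesis IS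
   `ROpLeaf (θ.res.V P)` and its conclusion IS `∀ k ≤ K, θ.res.S218 P k (densOfRecord₅ θ P k)` (`Iff.rfl` ∕ rewriting) — the two ends of the
   node at the record, located.
§2 **`b14_main_of_isRecordOfRecord₅`** — THE KNIT AT THE RECORD PREDICATE: if `(D, w)` is a Stage-5 record and, for the parameters `θ` of
   the record (every admissible `θ` with `D = datumOfRecord₅ θ` and `w.up = upOfRecord₅ θ`), every run carries space families `S`, `Scorr`
   with (P1₅), (P3₅), (S0), (S1), then `∀ P, Dag.B14_main (leavesP w P)`.  `b14_main_forall_isRecordOfRecord₅`: the `S_N11 Rec₅` shape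
   `∀ D w, IsRecordOfRecord₅ F N D w → ∀ P, Dag.B14_main (leavesP w P)` from the slots stated once over all admissible `θ` at the
   constant-binding worlds.

HONEST FRAMING.  A count-neutral SLOT landing (R429 (4)(i)): N11 is NOT discharged; (S1) = Sects. 1–3 of [Balaban1988Convergent] at the
objects of record is a displayed hypothesis, statable in closed form only once the Stage-6 format predicates replace `Residual₅.S218` and
its T-image companion; (P1₅) waits on Stage 7.  The 𝐑 operation is the printed ASSUMPTION of p. 244.  One finite four-torus programme at
fixed `ε`, Bałaban AS PRINTED with locators; nothing continuum ∕ ℝ⁴ ∕ OS ∕ mass gap ∕ Clay.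
-/

noncomputable section

namespace Literature.MathematicalPhysics.QuantumFieldTheory.Balaban1983to89.B14NodeKnitRecord5

open DagBinding T4DatumAssembly T4Continuum Node00

variable (F : T4Family) (N : ℕ) [NeZero N]

/-! ## §1. At the Stage-5 parameters `θ`: a world bound to `datumOfRecord₅ θ` with the upstream block of record at the run `P` -/

section AtParams

variable (θ : Stage5Params F N) (w : WorldP) (P : B12.RunParams)

/-- At a world whose upstream block at `P` is the record's, the node's 𝐑-hypothesis IS the bound leaf of the RESIDUAL 𝐑-carrier
`ROpLeaf (θ.res.V P)` (`DagDischargedII.ofPrintedAllXPN_leaves`). [cite: Balaban1988Convergent, p.244] -/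
theorem rOperation_iff_rOpLeaf_res (hup : w.up P = upOfRecord₅ F N θ P) :
    (leavesP w P).rOperation ↔ ROpLeaf (θ.res.V P) := by
  show (w.up P).rOperation ↔ _
  rw [hup]
  exact Iff.rfl

/-- At a world bound to the datum of record at `θ`, the node's conclusion `densitiesDescribed` IS «`ρ_k` has the (2.18) format for every
`k ≤ K`» at the DETERMINED densities of record: `∀ k ≤ P.K, θ.res.S218 P k (densOfRecord₅ F N θ P k)` (`Node00.sect2Form_datumOfRecord₅_iff`).
[cite: Balaban1988Convergent, Thm 1 p.262; (2.18) p.257] -/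
theorem densitiesDescribed_iff_S218 (hC : w.C = (datumOfRecord₅ F N θ).C) :
    (leavesP w P).densitiesDescribed ↔ ∀ k, k ≤ P.K → θ.res.S218 P k (densOfRecord₅ F N θ P k) := by
  show (∀ k, k ≤ P.K → (w.C P).Sect2Form k) ↔ _
  rw [hC]
  exact Iff.rfl

/-- **N11 AT THE STAGE-5 PARAMETERS `θ`** ([Balaban1988Convergent] Thm 1 p. 262 with the Theorem of p. 245 and the assumed 𝐑 of p. 244):
for a world bound to the datum of record at `θ` (`hC`) whose upstream block at the run `P` is the record's (`hup`), `Dag.B14_main (leavesP w P)`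
follows from the two located pins on the residual fields — (P1₅) `hV` the bound leaf of the residual 𝐑-carrier gives the p. 244 assumption for
the record's `R` and the space families `S`, `Scorr`; (P3₅) `hS` the index-`k` space implies the (2.18) format `θ.res.S218 P k` at `ρ_k` —
and EXACTLY TWO DISPLAYED PRINTED SLOTS: (S0) `h0` the Wilson start of record `rhoZeroOfRecord F N P.K P.g0 (θ.res.E P)` lies in the index-0
space, under the interval hypothesis; (S1) `hT` THE THEOREM OF p. 245 along the record's tower `densOfRecord₅ θ P` through NODE 00's
renormalisation transform of record `TrhoOfRecord F N P.K k`, GIVEN the in-edges `b7 … b11`, the interval hypothesis, the small-field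
inductive assumptions and the flow control (2.6).  Proof = `B14NodeKnitMachine.b14_main_of_machine_record` at `machineOfRecord₅ θ` +
`dens_machineOfRecord₅`.  Count-neutral; nothing of Sects. 1–3 asserted. [cite: Balaban1988Convergent, Thm 1 p.262; Theorem p.245; p.244] -/
theorem b14_main_at_stage5Params (hC : w.C = (datumOfRecord₅ F N θ).C) (hup : w.up P = upOfRecord₅ F N θ P)
    (S Scorr : (k : ℕ) → Density (F.P P.K) k (SU N) → Prop)
    (hV : ROpLeaf (θ.res.V P) → B14.RAssumedP244 (θ.res.R P) Scorr S P.K)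
    (hS : ∀ k, k ≤ P.K → S k (densOfRecord₅ F N θ P k) → θ.res.S218 P k (densOfRecord₅ F N θ P k))
    (h0 : (leavesP w P).smallCouplings → S 0 (rhoZeroOfRecord F N P.K P.g0 (θ.res.E P)))
    (hT : (leavesP w P).b7 → (leavesP w P).b8 → (leavesP w P).b9 → (leavesP w P).b10 → (leavesP w P).b11 →
      (leavesP w P).smallCouplings → (leavesP w P).smallFieldInductive → (leavesP w P).flowControl →
        ∀ k, k < P.K → S k (densOfRecord₅ F N θ P k) →
          Scorr (k + 1) (TrhoOfRecord F N P.K k (densOfRecord₅ F N θ P k))) :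
    Dag.B14_main (leavesP w P) := by
  refine B14NodeKnitMachine.b14_main_of_machine_record F N (machineOfRecord₅ F N θ) w P hC S Scorr ?_ ?_ h0 ?_
  · intro hrop
    exact hV ((rOperation_iff_rOpLeaf_res F N θ w P hup).1 hrop)
  · intro k hk h
    rw [dens_machineOfRecord₅] at h
    exact hS k hk h
  · intro h7 h8 h9 h10 h11 hsc hsf hfc k hk h
    rw [dens_machineOfRecord₅] at h ⊢
    exact hT h7 h8 h9 h10 h11 hsc hsf hfc k hk h

/-- The same with the index-`k` space THE (2.18) FORMAT ITSELF, `S := θ.res.S218 P` (no pin (P3₅)): N11 at `(w, P)` from (P1₅), the start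
and the T-step. [cite: Balaban1988Convergent, Thm 1 p.262; Theorem p.245; p.244] -/
theorem b14_main_at_stage5Params_S218 (hC : w.C = (datumOfRecord₅ F N θ).C) (hup : w.up P = upOfRecord₅ F N θ P)
    (Scorr : (k : ℕ) → Density (F.P P.K) k (SU N) → Prop)
    (hV : ROpLeaf (θ.res.V P) → B14.RAssumedP244 (θ.res.R P) Scorr (θ.res.S218 P) P.K)
    (h0 : (leavesP w P).smallCouplings → θ.res.S218 P 0 (rhoZeroOfRecord F N P.K P.g0 (θ.res.E P)))
    (hT : (leavesP w P).b7 → (leavesP w P).b8 → (leavesP w P).b9 → (leavesP w P).b10 → (leavesP w P).b11 →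
      (leavesP w P).smallCouplings → (leavesP w P).smallFieldInductive → (leavesP w P).flowControl →
        ∀ k, k < P.K → θ.res.S218 P k (densOfRecord₅ F N θ P k) →
          Scorr (k + 1) (TrhoOfRecord F N P.K k (densOfRecord₅ F N θ P k))) :
    Dag.B14_main (leavesP w P) :=
  b14_main_at_stage5Params F N θ w P hC hup (θ.res.S218 P) Scorr hV (fun _ _ h => h) h0 hT

end AtParams

/-! ## §2. At the record predicate `IsRecordOfRecord₅ F N D w` -/

section AtRecord

variable {F N}
variable {D : FiniteEpsData F (SU N)} {w : WorldP}

/-- **N11 AT NODE 00's STAGE-5 RECORD, KNIT BY NAME** ([Balaban1988Convergent] Thm 1 p. 262 with the Theorem of p. 245 and the assumed 𝐑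
of p. 244): if `(D, w)` is a Stage-5 record (`IsRecordOfRecord₅ F N D w`) and, for the parameters of the record — every admissible `θ` with
`D = datumOfRecord₅ θ` and `w.up = upOfRecord₅ θ` — every run carries space families `S`, `Scorr` with the located pins (P1₅), (P3₅) and the
displayed printed slots (S0), (S1) of `b14_main_at_stage5Params`, then N11 holds at every run.  Count-neutral slot landing.
[cite: Balaban1988Convergent, Thm 1 p.262; Theorem p.245; p.244] -/
theorem b14_main_of_isRecordOfRecord₅ (h : IsRecordOfRecord₅ F N D w)
    (slots : ∀ θ : Stage5Params F N, θ.Admissible → D = datumOfRecord₅ F N θ →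
      (∀ P, w.up P = upOfRecord₅ F N θ P) → ∀ P : B12.RunParams,
        ∃ S Scorr : (k : ℕ) → Density (F.P P.K) k (SU N) → Prop,
          (ROpLeaf (θ.res.V P) → B14.RAssumedP244 (θ.res.R P) Scorr S P.K) ∧
          (∀ k, k ≤ P.K → S k (densOfRecord₅ F N θ P k) → θ.res.S218 P k (densOfRecord₅ F N θ P k)) ∧
          ((leavesP w P).smallCouplings → S 0 (rhoZeroOfRecord F N P.K P.g0 (θ.res.E P))) ∧
          ((leavesP w P).b7 → (leavesP w P).b8 → (leavesP w P).b9 → (leavesP w P).b10 → (leavesP w P).b11 →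
            (leavesP w P).smallCouplings → (leavesP w P).smallFieldInductive → (leavesP w P).flowControl →
              ∀ k, k < P.K → S k (densOfRecord₅ F N θ P k) →
                Scorr (k + 1) (TrhoOfRecord F N P.K k (densOfRecord₅ F N θ P k)))) :
    ∀ P : B12.RunParams, Dag.B14_main (leavesP w P) := by
  intro P
  obtain ⟨θ, hθ, hD, hC, -, -, hup⟩ := h
  obtain ⟨S, Scorr, hV, hS, h0, hT⟩ := slots θ hθ hD hup P
  exact b14_main_at_stage5Params F N θ w P (by rw [hC, hD]) (hup P) S Scorr hV hS h0 hT

/-- **The `S_N11 Rec₅` shape**: `∀ D w, IsRecordOfRecord₅ F N D w → ∀ P, Dag.B14_main (leavesP w P)` from the slots stated ONCE over all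
admissible parameters `θ` at the worlds carrying the record's construction and upstream block — the form a `stub_N11` typed over the
Stage-5 record predicate takes (R422).  The slot's antecedents are the node's own (in-edges, interval hypothesis, small-field inductive
assumptions, flow control) at such a world. [cite: Balaban1988Convergent, Thm 1 p.262; Theorem p.245; p.244] -/
theorem b14_main_forall_isRecordOfRecord₅
    (slots : ∀ θ : Stage5Params F N, θ.Admissible → ∀ w : WorldP, w.C = (datumOfRecord₅ F N θ).C →
      (∀ P, w.up P = upOfRecord₅ F N θ P) → ∀ P : B12.RunParams,
        ∃ S Scorr : (k : ℕ) → Density (F.P P.K) k (SU N) → Prop,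
          (ROpLeaf (θ.res.V P) → B14.RAssumedP244 (θ.res.R P) Scorr S P.K) ∧
          (∀ k, k ≤ P.K → S k (densOfRecord₅ F N θ P k) → θ.res.S218 P k (densOfRecord₅ F N θ P k)) ∧
          ((leavesP w P).smallCouplings → S 0 (rhoZeroOfRecord F N P.K P.g0 (θ.res.E P))) ∧
          ((leavesP w P).b7 → (leavesP w P).b8 → (leavesP w P).b9 → (leavesP w P).b10 → (leavesP w P).b11 →
            (leavesP w P).smallCouplings → (leavesP w P).smallFieldInductive → (leavesP w P).flowControl →
              ∀ k, k < P.K → S k (densOfRecord₅ F N θ P k) →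
                Scorr (k + 1) (TrhoOfRecord F N P.K k (densOfRecord₅ F N θ P k)))) :
    ∀ (D : FiniteEpsData F (SU N)) (w : WorldP), IsRecordOfRecord₅ F N D w →
      ∀ P : B12.RunParams, Dag.B14_main (leavesP w P) := by
  intro D w h P
  obtain ⟨θ, hθ, hD, hC, -, -, hup⟩ := h
  obtain ⟨S, Scorr, hV, hS, h0, hT⟩ := slots θ hθ w (by rw [hC, hD]) hup P
  exact b14_main_at_stage5Params F N θ w P (by rw [hC, hD]) (hup P) S Scorr hV hS h0 hT

end AtRecord

end Literature.MathematicalPhysics.QuantumFieldTheory.Balaban1983to89.B14NodeKnitRecord5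

end
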